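import Literature.MathematicalPhysics.QuantumLattice.LTQOProofs
import Literature.MathematicalPhysics.QuantumLattice.SpinTwistedHubbardTorus
import Mathlib.Analysis.SpecialFunctions.Integrals.Basic
import HarnessLib

/-!
# Route BalabanIR — crux 4 `BirGappedPhaseReduction` (item `stmt-HubbardSuperconductivity-2082`): the canonical projection as the exact integral over the global gauge (zero) modes

Informal step (3) of the reduction's dictionary: "the `(N_L, S^z = 0)` canonical projection is the
exact integral over the `k_s = 0` temporal modes of `θ`". On the operator side this is character
orthogonality for the `U(1) × U(1)` symmetry `(N↑, N↓)` of the Hubbard model: the orthogonal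
projection onto the joint sector `szSector (a + b) ((a - b)/2)` (`a` up, `b` down electrons) is
`P_{(a,b)} = (2π)⁻² ∫₀^{2π}∫₀^{2π} e^{-i(aφ + bχ)} U(φ,χ) dχ dφ` with the twist
`U(φ,χ) = e^{i(φ N↑ + χ N↓)} = diag (e^{i(φ #↑s + χ #↓s)})`, so every canonical (sector) trace
`tr (P_{(a,b)} X)` is a double Fourier coefficient of twisted traces `tr (U(φ,χ) X)` — for
`X = e^{-βH} A`, grand-canonical-type traces with imaginary spin-resolved chemical potentials, the
objects a functional-integral representation produces. Proved here, with NO new definition (the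
twist is an explicit diagonal matrix, identified with the exponential of the tree's spin-resolved
number operators in `spinTwist_eq_exp`):

* `isInSector_iff_mem_szSector` (`IsInSector a b ψ ↔ ψ ∈ szSector (a + b) ((a - b)/2)`; the tree
  had `a = b`, `mem_szSector_two_mul_zero_iff`); `projMatrix_szSector_eq_diagonal` — the
  projection matrix onto (the Euclidean transport of) the joint sector is the diagonal sector
  indicator (uniqueness of the orthogonal projection `eq_projMatrix_map_of_mulVec` applied to
  Lieb's `sectorProj`), with the route's case `(2m, 0)` on the torus
  (`projMatrix_szSector_two_mul_zero_eq_diagonal`, `projMatrix_szSector_fermionTorus_eq_diagonal`);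
* `integral_cexp_int_mul` (`∫₀^{2π} e^{ikt} dt = 2π δ_{k,0}`), `trace_sectorIndicator_mul_eq_integral`,
  `trace_projMatrix_szSector_mul_eq_integral` — the displayed formula in trace form against any `X`;
* `commute_spinTwist_of_preservesSectors` / `_hamiltonian` / `_hubbardTorus` and the Gibbs-weight
  versions — the twist commutes with every `(N↑, N↓)`-block-diagonal matrix;
* `trace_sectorGibbs_hamiltonian_eq_integral`, `trace_sectorGibbs_hubbardTorus_eq_integral` — the
  canonical thermal traces `tr (P_S e^{-βH} A)` (the route: `S = szSector (2m) 0`,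
  `H = hubbardTorus 2 L t U`, the numerator/denominator of `birTraceBound_of_eventually_thermal`)
  as double Fourier integrals of twisted Gibbs traces.

This module is deliberately THESES-FREE (imports only Literature/Mathlib), so that a closing module
of the route may import it (materialisation rule of the route file, rev 5).
Sources: E. H. Lieb, PRL 62 (1989) 1201 (the `(N↑, N↓)` sectors); H. Tasaki, *Physics and
Mathematics of Quantum Many-Body Systems* (2020) §9.3, §10.1 (`U(1) × U(1)` symmetry); the
projection formula `P_N = (2π)⁻¹ ∫ e^{iφ(N̂ - N)} dφ` is folklore (number projection of BCS states).
-/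

noncomputable section

open scoped Matrix.Norms.L2Operator ComplexOrder MatrixOrder InnerProductSpace

namespace Summit.HubbardSuperconductivity.HubbardSuperconductivity.Theorems

open Matrix Complex MeasureTheory intervalIntegral Literature.MathematicalPhysics.QuantumLattice

/-! ### Character orthogonality on `[0, 2π]` -/

/-- `∫₀^{2π} e^{ikt} dt = 2π` if `k = 0` and `= 0` otherwise (`k ∈ ℤ`). [folklore] -/
theorem integral_cexp_int_mul (k : ℤ) :
    ∫ t in (0:ℝ)..2 * Real.pi, cexp ((k : ℂ) * (t : ℂ) * I) =
      if k = 0 then ((2 * Real.pi : ℝ) : ℂ) else 0 := by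
  split_ifs with hk
  · subst hk
    simp only [Int.cast_zero, zero_mul, Complex.exp_zero, intervalIntegral.integral_const,
      sub_zero, Complex.real_smul, mul_one]
  · have hc : (k : ℂ) * I ≠ 0 := mul_ne_zero (by exact_mod_cast hk) I_ne_zero
    have h1 : (fun t : ℝ => cexp ((k : ℂ) * (t : ℂ) * I)) = fun t : ℝ => cexp ((k : ℂ) * I * t) := by
      funext t
      ring_nf
    rw [h1, integral_exp_mul_complex hc]
    have h2 : cexp ((k : ℂ) * I * ((2 * Real.pi : ℝ) : ℂ)) = 1 := by
      rw [show (k : ℂ) * I * ((2 * Real.pi : ℝ) : ℂ) = k * (2 * Real.pi * I) by push_cast; ring]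
      exact Complex.exp_int_mul_two_pi_mul_I k
    rw [h2, Complex.ofReal_zero, mul_zero, Complex.exp_zero, sub_self, zero_div]

/-- A finite sum of characters integrates termwise:
`∫₀^{2π} Σ_s c_s e^{i k_s t} dt = Σ_s c_s · 2π δ_{k_s,0}`. [folklore] -/
theorem integral_sum_mul_cexp_int_mul {α : Type*} (S : Finset α) (c : α → ℂ) (k : α → ℤ) :
    ∫ t in (0:ℝ)..2 * Real.pi, ∑ s ∈ S, c s * cexp ((k s : ℂ) * (t : ℂ) * I) =
      ∑ s ∈ S, c s * (if k s = 0 then ((2 * Real.pi : ℝ) : ℂ) else 0) := by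
  rw [intervalIntegral.integral_finsetSum]
  · refine Finset.sum_congr rfl fun s _ => ?_
    rw [intervalIntegral.integral_const_mul, integral_cexp_int_mul]
  · intro s _
    exact (Continuous.intervalIntegrable (by fun_prop) _ _)

/-! ### The joint sectors `(N↑, N↓) = (a, b)` and their projections -/

section Sectors

variable {Λ : Type*} [LinearOrder Λ] [Fintype Λ]

/-- Lieb's `(a, b)` sector (`a` up, `b` down electrons) is the joint sector
`szSector (a + b) ((a - b)/2)` of the tree (`N = a + b`, `S^z = (a - b)/2`); the case `a = b` is
`mem_szSector_two_mul_zero_iff`. Lieb, PRL 62 (1989) 1201. [folklore] -/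
theorem isInSector_iff_mem_szSector (a b : ℕ) (ψ : Fock (Orb Λ)) :
    IsInSector a b ψ ↔ ψ ∈ szSector (a + b) (((a : ℝ) - b) / 2) := by
  rw [mem_szSector_iff]
  constructor
  · intro h
    refine ⟨h.isNParticle, ?_⟩
    rw [LiebThm1.spinZ_mulVec_of_isInSector h]
    congr 1
    push_cast
    ring
  · rintro ⟨hN, hZ⟩ s hs
    by_contra hne
    have hcard : s.card = a + b := by
      by_contra hc
      exact hne (hN s hc)
    have hz := congrFun hZ s
    rw [LiebThm1.spinZ_mulVec_apply, Pi.smul_apply, smul_eq_mul] at hz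
    have hz' : (1 / 2 : ℂ) * (((upPart s).card : ℂ) - ((downPart s).card : ℂ)) =
        ((((a : ℝ) - b) / 2 : ℝ) : ℂ) := mul_right_cancel₀ hne hz
    have h3 : (((1 : ℝ) / 2 * (((upPart s).card : ℝ) - (downPart s).card) : ℝ) : ℂ) =
        ((((a : ℝ) - b) / 2 : ℝ) : ℂ) := by
      rw [← hz']
      push_cast
      ring
    have h4 := Complex.ofReal_injective h3
    have hsum : ((upPart s).card : ℝ) + (downPart s).card = a + b := by
      have h5 := card_eq_upPart_add_downPart s
      rw [hcard] at h5
      exact_mod_cast h5.symm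
    apply hs
    constructor
    · have : ((upPart s).card : ℝ) = a := by linarith
      exact_mod_cast this
    · have : ((downPart s).card : ℝ) = b := by linarith
      exact_mod_cast this

/-- The diagonal sector indicator acts as Lieb's sector projection `sectorProj a b`. [folklore] -/
theorem diagonal_sectorIndicator_mulVec (a b : ℕ) (ψ : Fock (Orb Λ)) :
    (diagonal fun s : Finset (Orb Λ) =>
        if (upPart s).card = a ∧ (downPart s).card = b then (1 : ℂ) else 0) *ᵥ ψ =
      sectorProj a b ψ := by
  funext s
  rw [mulVec_diagonal, sectorProj_apply]
  split_ifs <;> simp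

/-- **The projection onto a joint sector is the diagonal sector indicator.** For the joint sector
`szSector (a + b) ((a - b)/2)` (transported to `EuclideanSpace` along `Fock.toEuclidean`, as in
the route's target), `projMatrix = diag (𝟙[#↑s = a ∧ #↓s = b])`: the indicator matrix is
Hermitian, fixes the sector pointwise and maps every vector into it, so it is the orthogonal
projection (`eq_projMatrix_map_of_mulVec`). Lieb, PRL 62 (1989) 1201; Tasaki (2020) App. A.2.
[folklore] -/
theorem projMatrix_szSector_eq_diagonal (a b : ℕ) :
    projMatrix ((szSector (Λ := Λ) (a + b) (((a : ℝ) - b) / 2)).map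
        (Fock.toEuclidean (ι := Orb Λ) : Fock (Orb Λ) →ₗ[ℂ] EuclideanSpace ℂ (Finset (Orb Λ)))) =
      diagonal fun s : Finset (Orb Λ) =>
        if (upPart s).card = a ∧ (downPart s).card = b then (1 : ℂ) else 0 := by
  symm
  refine eq_projMatrix_map_of_mulVec _ ?_ ?_ ?_
  · rw [IsHermitian, diagonal_conjTranspose]
    congr 1
    funext s
    by_cases h : (upPart s).card = a ∧ (downPart s).card = b <;> simp [h]
  · intro k hk
    rw [diagonal_sectorIndicator_mulVec]
    exact sectorProj_eq_self ((isInSector_iff_mem_szSector a b k).2 hk)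
  · intro v
    rw [diagonal_sectorIndicator_mulVec]
    exact (isInSector_iff_mem_szSector a b _).1 (isInSector_sectorProj a b v)

/-- The route's case `(N, S^z) = (2m, 0)`: the projection onto `szSector (2m) 0` is
`diag (𝟙[#↑s = m ∧ #↓s = m])`. Lieb, PRL 62 (1989) 1201. [folklore] -/
theorem projMatrix_szSector_two_mul_zero_eq_diagonal (m : ℕ) :
    projMatrix ((szSector (Λ := Λ) (2 * m) 0).map
        (Fock.toEuclidean (ι := Orb Λ) : Fock (Orb Λ) →ₗ[ℂ] EuclideanSpace ℂ (Finset (Orb Λ)))) =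
      diagonal fun s : Finset (Orb Λ) =>
        if (upPart s).card = m ∧ (downPart s).card = m then (1 : ℂ) else 0 := by
  have h := projMatrix_szSector_eq_diagonal (Λ := Λ) m m
  rwa [← two_mul, sub_self, zero_div] at h

/-- The dimension of a joint sector: `tr P_{(a,b)} = #{s : #↑s = a ∧ #↓s = b}`. [folklore] -/
theorem trace_projMatrix_szSector (a b : ℕ) :
    (projMatrix ((szSector (Λ := Λ) (a + b) (((a : ℝ) - b) / 2)).map
        (Fock.toEuclidean (ι := Orb Λ) : Fock (Orb Λ) →ₗ[ℂ] EuclideanSpace ℂ (Finset (Orb Λ))))).trace =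
      ((Finset.univ.filter fun s : Finset (Orb Λ) =>
        (upPart s).card = a ∧ (downPart s).card = b).card : ℂ) := by
  rw [projMatrix_szSector_eq_diagonal, trace_diagonal, Finset.sum_boole]

/-! ### The spin-resolved global gauge twist `U(φ, χ) = e^{i(φ N↑ + χ N↓)}` -/

/-- The twist `diag (e^{i(φ #↑s + χ #↓s)})` is the exponential `exp (iφ N↑ + iχ N↓)` of the
spin-resolved number operators `N_σ = Σ_x n_{xσ}` (both diagonal in the occupation basis,
`sum_numberOp_zero_eq_diagonal`, `sum_numberOp_one_eq_diagonal`). Tasaki (2020) §9.3. [folklore] -/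
theorem spinTwist_eq_exp (φ χ : ℝ) :
    (diagonal fun s : Finset (Orb Λ) =>
        cexp (((((upPart s).card : ℝ) * φ + ((downPart s).card : ℝ) * χ : ℝ) : ℂ) * I)) =
      NormedSpace.exp (((φ : ℂ) * I) • (∑ x : Λ, numberOp x 0 :
          Matrix (Finset (Orb Λ)) (Finset (Orb Λ)) ℂ) +
        ((χ : ℂ) * I) • (∑ x : Λ, numberOp x 1 : Matrix (Finset (Orb Λ)) (Finset (Orb Λ)) ℂ)) := by
  rw [sum_numberOp_zero_eq_diagonal, sum_numberOp_one_eq_diagonal, ← diagonal_smul,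
    ← diagonal_smul, diagonal_add, Matrix.exp_diagonal]
  congr 1
  funext s
  rw [Pi.exp_def, Complex.exp_eq_exp_ℂ]
  simp only [Pi.smul_apply, smul_eq_mul]
  congr 1
  push_cast
  ring

/-- The twist commutes with every `(N↑, N↓)`-block-diagonal matrix (`PreservesSectors`). Lieb,
PRL 62 (1989) 1201, Remark (2)(i). [folklore] -/
theorem commute_spinTwist_of_preservesSectors {M : Matrix (Finset (Orb Λ)) (Finset (Orb Λ)) ℂ}
    (hM : PreservesSectors M) (φ χ : ℝ) :
    Commute M (diagonal fun s : Finset (Orb Λ) =>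
      cexp (((((upPart s).card : ℝ) * φ + ((downPart s).card : ℝ) * χ : ℝ) : ℂ) * I)) :=
  hM.commute_diagonal fun u d => cexp (((((u : ℝ) * φ + (d : ℝ) * χ : ℝ) : ℂ) * I))

/-! ### The Fourier formula for sector traces -/

/-- `tr (diag d · X) = Σ_s d_s X_{ss}`. [folklore] -/
theorem trace_diagonal_mul_eq_sum {n : Type*} [Fintype n] [DecidableEq n] (d : n → ℂ)
    (X : Matrix n n ℂ) : (diagonal d * X).trace = ∑ i, d i * X i i := by simp [Matrix.trace]

/-- **Canonical traces as double Fourier coefficients of twisted traces.** For every matrix `X`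
on the Fock space,
`tr (𝟙_{(a,b)} X) = (2π)⁻² ∫₀^{2π}∫₀^{2π} e^{-i(aφ + bχ)} tr (U(φ,χ) X) dχ dφ` with the twist
`U(φ,χ) = diag (e^{i(φ #↑s + χ #↓s)})` (character orthogonality of `U(1) × U(1)` applied entrywise
on the diagonal). Folklore (particle-number projection); Tasaki (2020) §9.3. [folklore] -/
theorem trace_sectorIndicator_mul_eq_integral (a b : ℕ) (X : Matrix (Finset (Orb Λ)) (Finset (Orb Λ)) ℂ) :
    ((diagonal fun s : Finset (Orb Λ) =>
        if (upPart s).card = a ∧ (downPart s).card = b then (1 : ℂ) else 0) * X).trace =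
      (1 / (2 * Real.pi) ^ 2 : ℂ) *
        ∫ φ in (0:ℝ)..2 * Real.pi, ∫ χ in (0:ℝ)..2 * Real.pi,
          cexp (-((((a : ℝ) * φ + (b : ℝ) * χ : ℝ) : ℂ) * I)) *
            ((diagonal fun s : Finset (Orb Λ) =>
              cexp (((((upPart s).card : ℝ) * φ + ((downPart s).card : ℝ) * χ : ℝ) : ℂ) * I)) *
                X).trace := by
  -- the integrand, expanded along the diagonal
  have hint : ∀ φ χ : ℝ,
      cexp (-((((a : ℝ) * φ + (b : ℝ) * χ : ℝ) : ℂ) * I)) *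
          ((diagonal fun s : Finset (Orb Λ) =>
            cexp (((((upPart s).card : ℝ) * φ + ((downPart s).card : ℝ) * χ : ℝ) : ℂ) * I)) *
              X).trace =
        ∑ s : Finset (Orb Λ), (X s s * cexp (((((upPart s).card : ℤ) - a : ℤ) : ℂ) * (φ : ℂ) * I)) *
          cexp (((((downPart s).card : ℤ) - b : ℤ) : ℂ) * (χ : ℂ) * I) := by
    intro φ χ
    rw [trace_diagonal_mul_eq_sum, Finset.mul_sum]
    refine Finset.sum_congr rfl fun s _ => ?_
    conv_lhs => rw [← mul_assoc, ← Complex.exp_add, mul_comm]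
    conv_rhs => rw [mul_assoc, ← Complex.exp_add]
    congr 2
    push_cast
    ring
  -- inner integral over `χ`
  have hinner : ∀ φ : ℝ,
      ∫ χ in (0:ℝ)..2 * Real.pi, cexp (-((((a : ℝ) * φ + (b : ℝ) * χ : ℝ) : ℂ) * I)) *
          ((diagonal fun s : Finset (Orb Λ) =>
            cexp (((((upPart s).card : ℝ) * φ + ((downPart s).card : ℝ) * χ : ℝ) : ℂ) * I)) *
              X).trace =
        ∑ s : Finset (Orb Λ), (X s s * (if ((downPart s).card : ℤ) - b = 0 then
            ((2 * Real.pi : ℝ) : ℂ) else 0)) *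
          cexp (((((upPart s).card : ℤ) - a : ℤ) : ℂ) * (φ : ℂ) * I) := by
    intro φ
    simp_rw [hint φ]
    rw [integral_sum_mul_cexp_int_mul]
    refine Finset.sum_congr rfl fun s _ => ?_
    ring
  simp_rw [hinner]
  rw [integral_sum_mul_cexp_int_mul, trace_diagonal_mul_eq_sum, Finset.mul_sum]
  refine Finset.sum_congr rfl fun s _ => ?_
  have hπ : ((2 * Real.pi : ℝ) : ℂ) ≠ 0 := by
    exact_mod_cast (mul_ne_zero two_ne_zero Real.pi_ne_zero)
  by_cases hu : (upPart s).card = a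
  · by_cases hd : (downPart s).card = b
    · rw [if_pos ⟨hu, hd⟩, if_pos (by rw [hd]; ring), if_pos (by rw [hu]; ring)]
      field_simp
      push_cast
      ring
    · have hd' : ((downPart s).card : ℤ) - b ≠ 0 := by
        intro h
        exact hd (by exact_mod_cast (sub_eq_zero.1 h))
      rw [if_neg (fun h => hd h.2), if_neg hd']
      simp
  · have hu' : ((upPart s).card : ℤ) - a ≠ 0 := by
      intro h
      exact hu (by exact_mod_cast (sub_eq_zero.1 h))
    rw [if_neg (fun h => hu h.1), if_neg hu']
    simp

/-- **The canonical projection as the exact integral over the global gauge modes** (trace form):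
for every matrix `X` on the Fock space and every joint sector `(N, S^z) = (a + b, (a - b)/2)`,
`tr (P_{szSector} X) = (2π)⁻² ∫₀^{2π}∫₀^{2π} e^{-i(aφ + bχ)} tr (U(φ,χ) X) dχ dφ`,
`U(φ,χ) = diag (e^{i(φ #↑s + χ #↓s)}) = exp (iφ N↑ + iχ N↓)` (`spinTwist_eq_exp`).
Folklore (particle-number projection); Lieb, PRL 62 (1989) 1201. [folklore] -/
theorem trace_projMatrix_szSector_mul_eq_integral (a b : ℕ)
    (X : Matrix (Finset (Orb Λ)) (Finset (Orb Λ)) ℂ) :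
    (projMatrix ((szSector (Λ := Λ) (a + b) (((a : ℝ) - b) / 2)).map
        (Fock.toEuclidean (ι := Orb Λ) : Fock (Orb Λ) →ₗ[ℂ] EuclideanSpace ℂ (Finset (Orb Λ)))) *
          X).trace =
      (1 / (2 * Real.pi) ^ 2 : ℂ) *
        ∫ φ in (0:ℝ)..2 * Real.pi, ∫ χ in (0:ℝ)..2 * Real.pi,
          cexp (-((((a : ℝ) * φ + (b : ℝ) * χ : ℝ) : ℂ) * I)) *
            ((diagonal fun s : Finset (Orb Λ) =>
              cexp (((((upPart s).card : ℝ) * φ + ((downPart s).card : ℝ) * χ : ℝ) : ℂ) * I)) *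
                X).trace := by
  rw [projMatrix_szSector_eq_diagonal, trace_sectorIndicator_mul_eq_integral]

end Sectors

/-! ### Hubbard Hamiltonians: twisted Gibbs traces -/

section Graph

variable {Λ : Type*} [LinearOrder Λ] [Fintype Λ] (G : SimpleGraph Λ) [DecidableRel G.Adj]

/-- The twist `U(φ,χ)` commutes with the Hubbard Hamiltonian on any finite graph (`H` is block
diagonal in the `(N↑, N↓)` sectors, `LiebThm1.preservesSectors_hamiltonian`). Lieb, PRL 62 (1989)
1201, Remark (2)(i). [folklore] -/
theorem commute_spinTwist_hamiltonian (t U : ℝ) (φ χ : ℝ) :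
    Commute (hamiltonian G t U) (diagonal fun s : Finset (Orb Λ) =>
      cexp (((((upPart s).card : ℝ) * φ + ((downPart s).card : ℝ) * χ : ℝ) : ℂ) * I)) :=
  commute_spinTwist_of_preservesSectors (LiebThm1.preservesSectors_hamiltonian G t U) φ χ

/-- The twist commutes with the Gibbs weight `e^{-βH}` (`Commute.exp_right`). [folklore] -/
theorem commute_spinTwist_gibbsWeight_hamiltonian (t U β : ℝ) (φ χ : ℝ) :
    Commute (gibbsWeight β (hamiltonian G t U)) (diagonal fun s : Finset (Orb Λ) =>
      cexp (((((upPart s).card : ℝ) * φ + ((downPart s).card : ℝ) * χ : ℝ) : ℂ) * I)) := by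
  rw [gibbsWeight]
  exact ((commute_spinTwist_hamiltonian G t U φ χ).symm.smul_right _).exp_right.symm

/-- **Canonical thermal traces of the Hubbard model as Fourier integrals of twisted Gibbs
traces.** For `H = hamiltonian G t U`, `S = szSector (a + b) ((a - b)/2)` and any `A`:
`tr (P_S e^{-βH} A) = (2π)⁻² ∫₀^{2π}∫₀^{2π} e^{-i(aφ + bχ)} tr (U(φ,χ) e^{-βH} A) dχ dφ`, the twists
`U(φ,χ) = exp (iφ N↑ + iχ N↓)` commuting with `e^{-βH}` (`commute_spinTwist_gibbsWeight_hamiltonian`).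
Folklore (particle-number projection); Lieb, PRL 62 (1989) 1201. [folklore] -/
theorem trace_sectorGibbs_hamiltonian_eq_integral (t U β : ℝ) (a b : ℕ)
    (A : Matrix (Finset (Orb Λ)) (Finset (Orb Λ)) ℂ) :
    (projMatrix ((szSector (Λ := Λ) (a + b) (((a : ℝ) - b) / 2)).map
        (Fock.toEuclidean (ι := Orb Λ) : Fock (Orb Λ) →ₗ[ℂ] EuclideanSpace ℂ (Finset (Orb Λ)))) *
        gibbsWeight β (hamiltonian G t U) * A).trace =
      (1 / (2 * Real.pi) ^ 2 : ℂ) *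
        ∫ φ in (0:ℝ)..2 * Real.pi, ∫ χ in (0:ℝ)..2 * Real.pi,
          cexp (-((((a : ℝ) * φ + (b : ℝ) * χ : ℝ) : ℂ) * I)) *
            ((diagonal fun s : Finset (Orb Λ) =>
              cexp (((((upPart s).card : ℝ) * φ + ((downPart s).card : ℝ) * χ : ℝ) : ℂ) * I)) *
                (gibbsWeight β (hamiltonian G t U) * A)).trace := by
  rw [Matrix.mul_assoc, trace_projMatrix_szSector_mul_eq_integral]

end Graph

/-! ### The Hubbard torus of the route -/

section Torus

variable (d L : ℕ)

/-- The Hubbard torus is block diagonal in the `(N↑, N↓)` sectors. Lieb, PRL 62 (1989) 1201. [folklore] -/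
theorem preservesSectors_hubbardTorus (t U : ℝ) : PreservesSectors (hubbardTorus d L t U) :=
  LiebThm1.preservesSectors_hamiltonian (fermionTorusGraph d L) t U

/-- The twist `U(φ,χ)` commutes with the Hubbard Hamiltonian of the torus (instances synthesised
at the torus, as in the route's declarations). Lieb, PRL 62 (1989) 1201, Remark (2)(i). [folklore] -/
theorem commute_spinTwist_hubbardTorus (t U : ℝ) (φ χ : ℝ) :
    Commute (hubbardTorus d L t U) (diagonal fun s : Finset (Orb (FermionTorus d L)) =>
      cexp (((((upPart s).card : ℝ) * φ + ((downPart s).card : ℝ) * χ : ℝ) : ℂ) * I)) := by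
  convert commute_spinTwist_hamiltonian (fermionTorusGraph d L) t U φ χ using 2
  rfl

/-- The twist commutes with the Gibbs weight `e^{-βH}` of the Hubbard torus. [folklore] -/
theorem commute_spinTwist_gibbsWeight_hubbardTorus (t U β : ℝ) (φ χ : ℝ) :
    Commute (gibbsWeight β (hubbardTorus d L t U))
      (diagonal fun s : Finset (Orb (FermionTorus d L)) =>
        cexp (((((upPart s).card : ℝ) * φ + ((downPart s).card : ℝ) * χ : ℝ) : ℂ) * I)) := by
  convert commute_spinTwist_gibbsWeight_hamiltonian (fermionTorusGraph d L) t U β φ χ using 2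
  rfl

/-- The projection onto the route's sector `szSector (2m) 0` of the torus is the diagonal sector
indicator (instances synthesised at the torus, as in the route's target). [folklore] -/
theorem projMatrix_szSector_fermionTorus_eq_diagonal (m : ℕ) :
    projMatrix ((szSector (Λ := FermionTorus d L) (2 * m) 0).map
        (Fock.toEuclidean (ι := Orb (FermionTorus d L)) :
          Fock (Orb (FermionTorus d L)) →ₗ[ℂ] EuclideanSpace ℂ (Finset (Orb (FermionTorus d L))))) =
      diagonal fun s : Finset (Orb (FermionTorus d L)) =>
        if (upPart s).card = m ∧ (downPart s).card = m then (1 : ℂ) else 0 := by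
  convert projMatrix_szSector_two_mul_zero_eq_diagonal (Λ := FermionTorus d L) m using 2

/-- **The route's canonical thermal traces as Fourier integrals of twisted Gibbs traces.**
`H = hubbardTorus 2 L t U`, `S = szSector (2m) 0`, any `A`:
`tr (P_S e^{-βH} A) = (2π)⁻² ∫₀^{2π}∫₀^{2π} e^{-im(φ + χ)} tr (U(φ,χ) e^{-βH} A) dχ dφ` (numerator,
and with `A = 1` denominator, of the canonical Gibbs average in `birTraceBound_of_eventually_thermal`;
the twists commute with `e^{-βH}`, `commute_spinTwist_gibbsWeight_hubbardTorus`). [folklore] -/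
theorem trace_sectorGibbs_hubbardTorus_eq_integral (t U β : ℝ) (m : ℕ)
    (A : Matrix (Finset (Orb (FermionTorus 2 L))) (Finset (Orb (FermionTorus 2 L))) ℂ) :
    (projMatrix ((szSector (Λ := FermionTorus 2 L) (2 * m) 0).map
        (Fock.toEuclidean (ι := Orb (FermionTorus 2 L)) :
          Fock (Orb (FermionTorus 2 L)) →ₗ[ℂ] EuclideanSpace ℂ (Finset (Orb (FermionTorus 2 L))))) *
        gibbsWeight β (hubbardTorus 2 L t U) * A).trace =
      (1 / (2 * Real.pi) ^ 2 : ℂ) *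
        ∫ φ in (0:ℝ)..2 * Real.pi, ∫ χ in (0:ℝ)..2 * Real.pi,
          cexp (-((((m : ℝ) * φ + (m : ℝ) * χ : ℝ) : ℂ) * I)) *
            ((diagonal fun s : Finset (Orb (FermionTorus 2 L)) =>
              cexp (((((upPart s).card : ℝ) * φ + ((downPart s).card : ℝ) * χ : ℝ) : ℂ) * I)) *
                (gibbsWeight β (hubbardTorus 2 L t U) * A)).trace := by
  rw [projMatrix_szSector_fermionTorus_eq_diagonal, Matrix.mul_assoc]
  convert trace_sectorIndicator_mul_eq_integral (Λ := FermionTorus 2 L) m m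
    (gibbsWeight β (hubbardTorus 2 L t U) * A)

end Torus

end Summit.HubbardSuperconductivity.HubbardSuperconductivity.Theorems
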